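import Mathlib
import Literature.AlgebraicGeometry.Tropical.InitialIdeal
import Literature.AlgebraicGeometry.Tropical.TropicalLink
import Summits.ResolutionOfSingularities.ResolutionOfSingularities.Theorems.TropicalLinksInductiveStepWeightZero
import Summits.ResolutionOfSingularities.ResolutionOfSingularities.Theorems.TropicalLinksInductiveStepWeightSplitting
import Summits.ResolutionOfSingularities.ResolutionOfSingularities.Theorems.TropicalLinksInductiveStepLaurentRegular
import Summits.ResolutionOfSingularities.ResolutionOfSingularities.Theorems.TropicalLinksInductiveStepLaurentRegularPi
import Summits.ResolutionOfSingularities.ResolutionOfSingularities.Theorems.TropicalLinksInductiveStepRayAlgebra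
import Summits.ResolutionOfSingularities.ResolutionOfSingularities.Theorems.TropicalLinksInductiveStepLaurentKer

/-!
# TropicalLinks / InductiveStep — the special fibre of the toric partial compactification along a
# weighted ray through an snc stratum is regular (roadmap brick C3)

Route `ResolutionOfSingularities/TropicalLinks`, crux `InductiveStep` (stmt-ResolutionOfSingularities-17233),
line `split`, in support of stub `stub_sncClosureSchon` (Luxton–Qu Prop. 3.1 through the dictionary
`tropicalLinks_isSchonIdeal_iff_forall_rayFibre`).  For the coordinate ring `A` of the star of an snc
stratum, local equations `m₁, …, m_l` of the boundary divisors through it (a permutable regular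
family: each `mᵢ` is a non-zero-divisor modulo any set of the others) and a ray `ρ = Σ bᵢ val_{Dᵢ}`
in the relative interior of the cone of the stratum (`bᵢ ≥ 1`), the closure of the very affine open
`Spec A[1/∏mᵢ]` in the partial compactification along `ρ` is `Spec A[m^a : a ∈ ℤ^l, ⟨b,a⟩ ≥ 0]`
(the RAY ALGEBRA `S`) and its special fibre is cut out by `J = (m^a : ⟨b,a⟩ > 0)`:

* `tropicalLinks_isNoetherianRing_laurent_ker` — `A[↥ker ⟨b,·⟩]` is Noetherian for Noetherian `A`;
* `tropicalLinks_isRegularRing_rayAlgebra_quotient` (registered brick C3) — **`S ⧸ J` is a regular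
  ring** when `A` is Noetherian and `A ⧸ (m₁, …, m_l)` (the stratum) is regular at every prime:
  by brick C1 (`tropicalLinks_nonempty_rayAlgebra_quotient_algEquiv`, weighted quasi-regularity)
  `S ⧸ J ≃ₐ[A] (A ⧸ (m))[↥ker ⟨b,·⟩]`, and by brick C2 (`tropicalLinks_forall_prime_regular_laurent_ker_iff`)
  that Laurent ring is regular iff `A ⧸ (m)` is — geometrically the fibre is `𝔾_m^{l-1} ×` (stratum)
  (Tevelev 2007 Thm. 1.4 / Luxton–Qu Prop. 3.1: "the structure map has fibre `S × ker(T_M → O_σ)`").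

No new definitions.
-/

-- single-problem summit: the doubled namespace component `ResolutionOfSingularities` is forced
set_option linter.dupNamespace false

namespace Summit.ResolutionOfSingularities.ResolutionOfSingularities.Theorems

open AddMonoidAlgebra Literature.AlgebraicGeometry.Tropical

/-- The Laurent ring over a Noetherian ring on the kernel lattice of a weight `b ∈ ℤ^l` is
Noetherian (the kernel is a direct summand of `ℤ^l`). [folklore] -/
theorem tropicalLinks_isNoetherianRing_laurent_ker (A : Type) [CommRing A] [IsNoetherianRing A]
    {l : ℕ} (b : Fin l → ℤ) :
    IsNoetherianRing (AddMonoidAlgebra A ↥(AddMonoidHom.ker (dotWeightHom b))) := by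
  haveI : IsNoetherianRing (AddMonoidAlgebra A (Fin l → ℤ)) := Algebra.FiniteType.isNoetherianRing A _
  by_cases hb : b = 0
  · -- the kernel is everything: `A[↥ker 0] ≃ A[ℤ^l]`
    have htop : AddMonoidHom.ker (dotWeightHom b) = ⊤ := by
      rw [eq_top_iff]
      intro v _
      rw [AddMonoidHom.mem_ker, coe_dotWeightHom, hb]
      exact dotWeight_zero v
    have e : (↥(AddMonoidHom.ker (dotWeightHom b))) ≃+ (Fin l → ℤ) :=
      (AddEquiv.addSubgroupCongr htop).trans AddSubgroup.topEquiv
    exact isNoetherianRing_of_ringEquiv _ (AddMonoidAlgebra.domCongr A A e).toRingEquiv.symm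
  · obtain ⟨ℓ, w₀, v₀, hℓ, hw, hv₀⟩ := tropicalLinks_exists_pos_mul_primitive_dotWeight hb
    obtain ⟨e, -⟩ := tropicalLinks_exists_addEquiv_prod_ker (dotWeightHom w₀) v₀ hv₀
    have hker : AddMonoidHom.ker (dotWeightHom b) = AddMonoidHom.ker (dotWeightHom w₀) := by
      ext v
      rw [AddMonoidHom.mem_ker, AddMonoidHom.mem_ker, coe_dotWeightHom, coe_dotWeightHom, ← hw v]
      exact ⟨fun h => (mul_eq_zero.1 h).resolve_left hℓ.ne', fun h => by rw [h, mul_zero]⟩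
    rw [hker]
    have E : AddMonoidAlgebra A (Fin l → ℤ) ≃+*
        AddMonoidAlgebra (AddMonoidAlgebra A ↥(AddMonoidHom.ker (dotWeightHom w₀))) ℤ :=
      (AddMonoidAlgebra.domCongr A A e).toRingEquiv.trans AddMonoidAlgebra.curryRingEquiv
    haveI : IsNoetherianRing (AddMonoidAlgebra (AddMonoidAlgebra A
        ↥(AddMonoidHom.ker (dotWeightHom w₀))) ℤ) := isNoetherianRing_of_ringEquiv _ E
    exact tropicalLinks_isNoetherianRing_of_laurent _

/-- **The special fibre of the ray algebra is a regular ring** (registered brick C3): with the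
hypotheses of brick C1 (positive weights `b`, permutable regular family `m`) and `A` Noetherian with
`A ⧸ (m₁, …, m_l)` regular at every prime, the quotient `S ⧸ J` of the ray algebra
`S = A[m^a : ⟨b,a⟩ ≥ 0] ⊆ A[1/∏mᵢ]` by the fibre ideal `J = (m^a : ⟨b,a⟩ > 0)` is a regular ring —
it is the Laurent ring `(A ⧸ (m))[↥ker ⟨b,·⟩]` (C1), regular by C2. [folklore] -/
theorem tropicalLinks_isRegularRing_rayAlgebra_quotient :
    ∀ (A : Type) [CommRing A] (l : ℕ) (m : Fin l → A) (b : Fin l → ℕ), (∀ i, 0 < b i) → (∀ (i : Fin l) (T : Set (Fin l)), i ∉ T → ∀ y : A, m i * y ∈ Ideal.span (m '' T) → y ∈ Ideal.span (m '' T)) → IsNoetherianRing A → (∀ (P : Ideal (A ⧸ Ideal.span (Set.range m))) [P.IsPrime], IsRegularLocalRing (Localization.AtPrime P)) → ∀ (v : Fin l → (Localization.Away (∏ i, m i))ˣ), (∀ i, (v i : Localization.Away (∏ i, m i)) = algebraMap A (Localization.Away (∏ i, m i)) (m i)) → ∀ (S : Subalgebra A (Localization.Away (∏ i, m i))), S =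 Algebra.adjoin A {x : Localization.Away (∏ i, m i) | ∃ a : Fin l → ℤ, 0 ≤ ∑ i, (b i : ℤ) * a i ∧ x = ((∏ i, v i ^ a i : (Localization.Away (∏ i, m i))ˣ) : Localization.Away (∏ i, m i))} → ∀ (J : Ideal ↥S), J = Ideal.span {x : ↥S | ∃ a : Fin l → ℤ, 0 < ∑ i, (b i : ℤ) * a i ∧ (x : Localization.Away (∏ i, m i)) = ((∏ i, v i ^ a i : (Localization.Away (∏ i, m i))ˣ) : Localization.Away (∏ i, m i))} → IsRegularRing (↥S ⧸ J) := by
  intro A _ l m b hb hperm hN hreg v hv S hS J hJ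
  obtain ⟨e⟩ := tropicalLinks_nonempty_rayAlgebra_quotient_algEquiv A l m b hb hperm v hv S hS J hJ
  haveI hNK : IsNoetherianRing (AddMonoidAlgebra (A ⧸ Ideal.span (Set.range m))
      ↥(AddMonoidHom.ker (dotWeightHom fun i => (b i : ℤ)))) :=
    tropicalLinks_isNoetherianRing_laurent_ker _ _
  have hregK : ∀ (P : Ideal (AddMonoidAlgebra (A ⧸ Ideal.span (Set.range m))
      ↥(AddMonoidHom.ker (dotWeightHom fun i => (b i : ℤ))))) [P.IsPrime],
      IsRegularLocalRing (Localization.AtPrime P) := by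
    rcases Nat.eq_zero_or_pos l with hl | hl
    · subst hl
      -- no variables: the kernel lattice is the trivial group, `A'[0] ≃ A'`
      haveI : Subsingleton ↥(AddMonoidHom.ker (dotWeightHom fun i : Fin 0 => (b i : ℤ))) :=
        ⟨fun x y => Subtype.ext (Subsingleton.elim _ _)⟩
      exact tropicalLinks_forall_prime_regular_of_ringEquiv
        (AddMonoidAlgebra.uniqueRingEquiv (R := A ⧸ Ideal.span (Set.range m))
          ↥(AddMonoidHom.ker (dotWeightHom fun i : Fin 0 => (b i : ℤ)))).symm hreg
    · have hb0 : (fun i => (b i : ℤ)) ≠ 0 := by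
        intro h
        have h0 := congrFun h ⟨0, hl⟩
        simp only [Pi.zero_apply, Nat.cast_eq_zero] at h0
        exact (hb _).ne' h0
      exact (tropicalLinks_forall_prime_regular_laurent_ker_iff (A ⧸ Ideal.span (Set.range m)) l _ hb0
        inferInstance).2 hreg
  haveI : IsRegularRing (AddMonoidAlgebra (A ⧸ Ideal.span (Set.range m))
      ↥(AddMonoidHom.ker (dotWeightHom fun i => (b i : ℤ)))) := isRegularRing_iff.2 hregK
  exact IsRegularRing.of_ringEquiv e.symm.toRingEquiv

end Summit.ResolutionOfSingularities.ResolutionOfSingularities.Theorems
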